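import Summits.AtomisticToContinuum.HydrodynamicLimit.Theses.AntiMazurCoboundaries
import Literature.Probability.Divergences.FDivVariational
import Literature.Analysis.FluidPDE.LocalForecastCorrector
import Mathlib.InformationTheory.KullbackLeibler.ChainRule

/-!
# Sketch — crux-ideate stmt-AtomisticToContinuum-9282 (KineticWindowGronwall), round 1, ideator 3 (gen 2)

First lemmas of the two idea cards filed by this seat:

* card `restricted-density-hybrids` — `hybridEntropyInequality` (PROVED here from Mathlib's KL chain rule
  `InformationTheory.klDiv_compProd_left` and the tree's Donsker–Varadhan-type bound
  `Literature.Probability.Divergences.integral_le_toReal_klDiv_add_integral`): the entropy inequality applied to a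
  HYBRID law `μB ⊗ₘ κ` (true block data, reference conditional elsewhere) against the reference `νB ⊗ₘ κ` is charged
  only the BLOCK entropy `KL(μB ‖ νB)`, while the exponential moment on the right is taken under the full reference
  — in the card, the flow-invariant homogeneous Gibbs law to which `KineticFluxLdDecay` applies verbatim.
* card `macroscopic-corridor-locality` — the typed target `MacroRangeInfluenceLocality` (statement only): influence
  locality in exponential moments at ONE fixed small amplitude `lam₀`, chosen BEFORE the window `τ`, the (macroscopic,
  `N`-independent) forecast range `R` and the accuracy `δ`, under INHOMOGENEOUS local Gibbs laws.
-/

noncomputable section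

namespace Summit.AtomisticToContinuum.HydrodynamicLimit.Cruxes.KineticWindowGronwall.IdeatorThreeG2

open MeasureTheory ProbabilityTheory InformationTheory
open scoped ENNReal

/-! ## Card `restricted-density-hybrids`: the hybrid entropy inequality -/

/-- **Hybrid entropy inequality.** For finite measures `μB, νB` on a "block data" space `S`, a Markov kernel
`κ : S → Ω` (in the card: the DLR conditional law of the homogeneous hard-sphere Gibbs state given the block
content) and any `g` on `S × Ω` (in the card: `b ·` the kinetic-window functional of the block's particles under
the TRUE torus dynamics — not block-measurable): the expectation of `g` under the HYBRID `μB ⊗ₘ κ` is bounded by the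
BLOCK entropy `KL(μB ‖ νB)` plus the exponential moment of `g` under the full reference `νB ⊗ₘ κ`.
Proof: DV-type bound for `(μB ⊗ₘ κ, νB ⊗ₘ κ)` and `klDiv_compProd_left`. [folklore] -/
theorem hybridEntropyInequality {S Ω : Type*} [MeasurableSpace S] [MeasurableSpace Ω]
    (μB νB : Measure S) [IsFiniteMeasure μB] [IsFiniteMeasure νB]
    (κ : Kernel S Ω) [IsMarkovKernel κ]
    (hfin : klDiv μB νB ≠ ∞) {g : S × Ω → ℝ}
    (hg : Integrable g (μB ⊗ₘ κ)) (hexp : Integrable (fun p => Real.exp (g p)) (νB ⊗ₘ κ)) :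
    ∫ p, g p ∂(μB ⊗ₘ κ) ≤ (klDiv μB νB).toReal + ∫ p, (Real.exp (g p) - 1) ∂(νB ⊗ₘ κ) := by
  have hfin' : klDiv (μB ⊗ₘ κ) (νB ⊗ₘ κ) ≠ ∞ := by rwa [klDiv_compProd_left]
  have h := Literature.Probability.Divergences.integral_le_toReal_klDiv_add_integral
    (μ := μB ⊗ₘ κ) (ν := νB ⊗ₘ κ) hfin' hg hexp
  rwa [klDiv_compProd_left] at h

/-- Scaled form used per kinetic window (parameter `b > 0`, in the card `b = κ'/(h C_g)`):
`∫ Y d(μB ⊗ₘ κ) ≤ b⁻¹ (KL(μB‖νB) + ∫ (e^{bY} - 1) d(νB ⊗ₘ κ))`. [folklore] -/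
theorem hybridEntropyInequality_scaled {S Ω : Type*} [MeasurableSpace S] [MeasurableSpace Ω]
    (μB νB : Measure S) [IsFiniteMeasure μB] [IsFiniteMeasure νB]
    (κ : Kernel S Ω) [IsMarkovKernel κ]
    (hfin : klDiv μB νB ≠ ∞) {Y : S × Ω → ℝ} {b : ℝ} (hb : 0 < b)
    (hY : Integrable Y (μB ⊗ₘ κ)) (hexp : Integrable (fun p => Real.exp (b * Y p)) (νB ⊗ₘ κ)) :
    ∫ p, Y p ∂(μB ⊗ₘ κ) ≤ b⁻¹ * ((klDiv μB νB).toReal + ∫ p, (Real.exp (b * Y p) - 1) ∂(νB ⊗ₘ κ)) := by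
  have h := hybridEntropyInequality μB νB κ hfin (g := fun p => b * Y p) (hY.const_mul b) hexp
  rw [integral_const_mul] at h
  rw [le_inv_mul_iff₀ hb]
  linarith

/-! ## Card `macroscopic-corridor-locality`: the typed target -/

open Literature.MathematicalPhysics.KineticTheory Literature.Analysis.FluidPDE Classical in
/-- **Influence locality across MACROSCOPIC corridors, in exponential moments at one fixed small amplitude,
under inhomogeneous local Gibbs laws.** For continuous positive profiles `(a, θ)`, `u`, and `σ < σ₀` there is an
amplitude `lam₀ > 0` (depending on the profiles and `σ` only — in the card any `lam₀` below an absolute O(1)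
energy-cascade cap `lam*`) such that for EVERY kinetic window `τ` (macroscopic length `τ (N+1)^{-1/3}`), EVERY macroscopic forecast range
`R > 0` (fixed as `N → ∞`, i.e. `R (N+1)^{1/3} → ∞` microscopic units — contrast `InfluenceLocality` 13916, whose
range is `R (N+1)^{-1/3}`) and every `δ > 0`, for `N ≥ N₀` and all flows / cluster flows, the number of particles
whose true state leaves its `R`-local forecast within the window has `∫ exp(lam₀ · #bad) ≤ e^{δ(N+1)}` under
`localGibbsLaw σ a u θ`. Quantifier order is the content: `lam₀` BEFORE `τ, R, δ` (window-uniform amplitude).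
[folklore] -/
def MacroRangeInfluenceLocality : Prop :=
  ∀ (a θ : T3 → ℝ) (u : T3 → V3), Continuous a → Continuous θ → Continuous u →
    (∀ x, 0 < a x) → (∀ x, 0 < θ x) →
    ∃ σ₀ : ℝ, 0 < σ₀ ∧ ∀ σ : ℝ, 0 < σ → σ < σ₀ → ∃ lam₀ : ℝ, 0 < lam₀ ∧
      ∀ (τ R δ : ℝ), 0 < τ → 0 < R → 0 < δ → ∃ N₀ : ℕ, ∀ N : ℕ, N₀ ≤ N →
        ∀ (Φ : HardSphereFlow (Torus.geometry (Fin 3)) (hsDiameter σ N) (N + 1))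
          (Ψ : (k : ℕ) → HardSphereFlow (Torus.geometry (Fin 3)) (hsDiameter σ N) k),
          ∫⁻ z, ENNReal.ofReal (Real.exp (lam₀ *
              ((Finset.univ.filter fun i : Fin (N + 1) =>
                  ∃ t ∈ Set.Icc (0 : ℝ) (τ * ((N + 1 : ℕ) : ℝ) ^ (-(1 / 3 : ℝ))),
                    Φ.flow t z i ≠ localClusterState Ψ R t z i).card : ℝ)))
            ∂(localGibbsLaw σ a u θ N Φ) ≤ ENNReal.ofReal (Real.exp (δ * (N + 1)))

open Literature.MathematicalPhysics.KineticTheory Literature.Analysis.FluidPDE Classical in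
/-- The homogeneous special case at fixed small amplitude is implied (constant profiles); recorded to pin the
direction of use in both cards (the hybrid card needs it under the homogeneous law on the density-rescaled torus
and under the smooth `ψ_t`). [folklore] -/
theorem macroRange_const_of_profiles (h : MacroRangeInfluenceLocality) (a θ : ℝ) (u : V3)
    (ha : 0 < a) (hθ : 0 < θ) :
    ∃ σ₀ : ℝ, 0 < σ₀ ∧ ∀ σ : ℝ, 0 < σ → σ < σ₀ → ∃ lam₀ : ℝ, 0 < lam₀ ∧
      ∀ (τ R δ : ℝ), 0 < τ → 0 < R → 0 < δ → ∃ N₀ : ℕ, ∀ N : ℕ, N₀ ≤ N →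
        ∀ (Φ : HardSphereFlow (Torus.geometry (Fin 3)) (hsDiameter σ N) (N + 1))
          (Ψ : (k : ℕ) → HardSphereFlow (Torus.geometry (Fin 3)) (hsDiameter σ N) k),
          ∫⁻ z, ENNReal.ofReal (Real.exp (lam₀ *
              ((Finset.univ.filter fun i : Fin (N + 1) =>
                  ∃ t ∈ Set.Icc (0 : ℝ) (τ * ((N + 1 : ℕ) : ℝ) ^ (-(1 / 3 : ℝ))),
                    Φ.flow t z i ≠ localClusterState Ψ R t z i).card : ℝ)))
            ∂(localGibbsLaw σ (fun _ => a) (fun _ => u) (fun _ => θ) N Φ) ≤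
            ENNReal.ofReal (Real.exp (δ * (N + 1))) :=
  h (fun _ => a) (fun _ => θ) (fun _ => u) continuous_const continuous_const continuous_const
    (fun _ => ha) (fun _ => hθ)

end Summit.AtomisticToContinuum.HydrodynamicLimit.Cruxes.KineticWindowGronwall.IdeatorThreeG2

end
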